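import Summits.QuantumFields.YangMills.Theorems.BalabanUVNodesPortS1RegThm1Rows

/-!
# NODE O port PT-A — (M8b) INTERPRETATION MAP: THE (1.12) LOCAL-GAUGE ROW OF `RegThm1RowsAtRecord` IS X-FREE AND FRAME-FREE — it follows from BOX-LOCAL GAUGES on the
# `s`-boxes of the fine torus, `s := side L Mc (k+2)` (one size, one level): the frame cubes of record are `regionOfSet (box ∩ Y)` and regions are monotone in the site set

Cell `ym-nodeO-ideate`, porter seat PT-A-1 (gen 12, «the [15] desk»; ★★★ director-ym №661 (2): «(M8b)'s interpretation-map lemma (frame cube ⊂ class cube, one level) is the one typable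
piece»); `--kind proof --supports stmt-QuantumFields-27930 --as helper`; count-neutral.  [I] = [Balaban1987RG1]; [15] = [Balaban1985Variational].

WHY.  ✓`RegThm1RowsAtRecord` (p833569) displays its (1.12) row over «every domain `X` and every cube `C ∈ (Sect2.frameI (R_z) Mc (k+1) (domSites X)).cubes`».  By lit's definition
(`Sect2.frameI … cubes := cubesI Mc (k+1) Y`, `Sect2.cubesI`), such a `C` is `regionOfSet (cubeEnl P s a 0 ∩ Y)` for an index `a ∈ cubeIndices P s` of the `s`-box partition of the fine torus,
`s = side P.L Mc (k+2)` («the LM-cubes of T^{(j)} = the M-cubes of T^{(j+1)}», j = k+1); and `regionOfSet` is monotone in the site set (lit ✓`regionOfSet_bonds_mono`,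
✓`regionOfSet_dpairs_mono`).  Hence the supplier of (M8b) may forget `X`, the domain system and the frame: it suffices to produce, for the ONE field `𝐔 = U_{k+1}(W_B)` and EVERY
`s`-box `□_a`, a `G`-valued `u` and an `A` with `𝐔^u = exp iξA` on the bonds of `□_a` and `|A|, |∇^ξ A| < c_B α₀` on its bonds ∕ derivative stencils — [15] Thm 1 (9) for cubes of ONE
size at the top level.  This file is that reduction (pure geometry; no estimate).
* §1 ★★ `localGaugeRow_of_boxGauges` — for ANY units-valued fine field `U`, box-local gauges on every `s`-box ⟹ the (1.12) row for every `X` and every frame cube (the row's text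
  verbatim, `U` in place of `recordBgUnits … B`).
* §2 ★ `regThm1GaugeRow_of_boxGauges` — the instance `U := recordBgUnits F θ k K B` (the letter's first conjunct verbatim at a class point).

HONEST FRAMING.  Bookkeeping (an `obtain` on the definition of the frame cubes + two monotonicity lemmas of lit); nothing of [15] Thm 1 (9) is proved — the box-local gauges are the
HYPOTHESIS; `RegThm1RowsAtRecord`, `RegClassNestsUc`, `stub_regClassNestsUc` stay OPEN; registry untouched (⟨27930⟩ 2∕7); NODE O 0∕1 · COUNT 8∕28 · K 1∕4 UNMOVED; finite `𝕋⁴_{L^K}`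
at fixed ε — NOT continuum ∕ OS; **the Yang–Mills mass gap (Clay) is NOT proved by any of this.**  No `sorry`, no `def`, no `instance`; standard axioms.
-/

noncomputable section

open scoped BigOperators Matrix.Norms.L2Operator Topology

namespace Summit.QuantumFields.YangMills.Theorems.BalabanUVNodesPortS1

open Summit.QuantumFields.YangMills.Theorems.K0RecordFormatNames
open Literature.MathematicalPhysics.QuantumFieldTheory.Balaban1983to89
open Literature.MathematicalPhysics.QuantumFieldTheory.Balaban1983to89.Node00
open Literature.MathematicalPhysics.QuantumFieldTheory.Balaban1983to89.T4Continuum (T4Family)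

variable (F : T4Family)

/-! ## §1  ★★ Box-local gauges ⟹ the (1.12) row on every frame cube of every domain -/

open scoped Classical in
/-- ★★ **THE (1.12) ROW IS X-FREE AND FRAME-FREE**: for any units-valued fine field `U` on the torus of the `K`-th approximation, IF on every `s`-box `□_a = cubeEnl P s a 0`
(`s := side P.L Mc (k+2)`, `a ∈ cubeIndices P s`) there are a `G`-valued `u` and an `A` with `U^u = exp iξA` on the bonds of `□_a`, `‖A b‖ < c_B α₀` on its bonds and
`‖∇^ξ A‖ < c_B α₀` on its derivative stencils (`ξ = η_{k+1}`, `c_B` of `StepConsts.ofParams … (recordCB F) (k+1)`), THEN the (1.12) row of ✓`RegThm1RowsAtRecord` holds for every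
domain `X` and every cube of the frame of record `Sect2.frameI (R_z) Mc (k+1) (domSites X)` — each such cube is `regionOfSet (□_a ∩ Y)` (lit `Sect2.cubesI`) and regions are
monotone in the site set.  Geometry only. [cite: Balaban1987RG1, (1.12) p.262 («for each cube □ ⊂ X of a size O(1)LM»); Balaban1985Variational, Thm 1 (9) p.279] -/
theorem localGaugeRow_of_boxGauges (Mc k K : ℕ) (Rz : Sect2.Residual (F.P K) (MatA 2)) (U : PBond (F.P K) 0 → (MatA 2)ˣ) {α₀ : ℝ}
    (hbox : ∀ a ∈ cubeIndices (F.P K) (B14.Eq213MaximalDomains.side (F.P K).L Mc (k + 2)),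
      ∃ u : Site (F.P K) 0 → (MatA 2)ˣ, (∀ x, u x ∈ (B12RegularSpaces111SpecialUnitary.suModel 2).G) ∧ ∃ A : PBond (F.P K) 0 → MatA 2,
        (∀ b ∈ (Sect2.regionOfSet (F.P K) (cubeEnl (F.P K) (B14.Eq213MaximalDomains.side (F.P K).L Mc (k + 2)) a 0)).bonds,
          B12RegularSpaces111.gaugeU u U b = B12RegularSpaces111.expI (B12RegularSpaces111.StepConsts.ofParams (F.P K) (recordCB F) (k + 1)).ξ (A b)) ∧
        (∀ b ∈ (Sect2.regionOfSet (F.P K) (cubeEnl (F.P K) (B14.Eq213MaximalDomains.side (F.P K).L Mc (k + 2)) a 0)).bonds,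
          ‖A b‖ < (B12RegularSpaces111.StepConsts.ofParams (F.P K) (recordCB F) (k + 1)).cB * α₀) ∧
        ∀ q ∈ (Sect2.regionOfSet (F.P K) (cubeEnl (F.P K) (B14.Eq213MaximalDomains.side (F.P K).L Mc (k + 2)) a 0)).dpairs,
          ‖B12RegularSpaces111.grad (B12RegularSpaces111.StepConsts.ofParams (F.P K) (recordCB F) (k + 1)).ξ q.2.1 (fun y => A ⟨y, q.2.2⟩) q.1‖ <
            (B12RegularSpaces111.StepConsts.ofParams (F.P K) (recordCB F) (k + 1)).cB * α₀)
    (X : (recordDomSys F Mc k K).Dom) :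
    ∀ C ∈ (Sect2.frameI Rz Mc (k + 1) (Sect2.domSites (F.P K) Mc (k + 1) X)).cubes,
      ∃ u : Site (F.P K) 0 → (MatA 2)ˣ, (∀ x, u x ∈ (B12RegularSpaces111SpecialUnitary.suModel 2).G) ∧ ∃ A : PBond (F.P K) 0 → MatA 2,
        (∀ b ∈ C.bonds, B12RegularSpaces111.gaugeU u U b = B12RegularSpaces111.expI (B12RegularSpaces111.StepConsts.ofParams (F.P K) (recordCB F) (k + 1)).ξ (A b)) ∧
        (∀ b ∈ C.bonds, ‖A b‖ < (B12RegularSpaces111.StepConsts.ofParams (F.P K) (recordCB F) (k + 1)).cB * α₀) ∧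
        ∀ q ∈ C.dpairs, ‖B12RegularSpaces111.grad (B12RegularSpaces111.StepConsts.ofParams (F.P K) (recordCB F) (k + 1)).ξ q.2.1 (fun y => A ⟨y, q.2.2⟩) q.1‖ <
          (B12RegularSpaces111.StepConsts.ofParams (F.P K) (recordCB F) (k + 1)).cB * α₀ := by
  intro C hC
  obtain ⟨a, ha, -, rfl⟩ := hC
  obtain ⟨u, hu, A, h1, h2, h3⟩ := hbox a ha
  have hb := Sect2.regionOfSet_bonds_mono (P := F.P K)
    (Set.inter_subset_left : cubeEnl (F.P K) (B14.Eq213MaximalDomains.side (F.P K).L Mc (k + 2)) a 0 ∩ Sect2.domSites (F.P K) Mc (k + 1) X ⊆ _)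
  have hq := Sect2.regionOfSet_dpairs_mono (P := F.P K)
    (Set.inter_subset_left : cubeEnl (F.P K) (B14.Eq213MaximalDomains.side (F.P K).L Mc (k + 2)) a 0 ∩ Sect2.domSites (F.P K) Mc (k + 1) X ⊆ _)
  exact ⟨u, hu, A, fun b hb' => h1 b (hb hb'), fun b hb' => h2 b (hb hb'), fun q hq' => h3 q (hq hq')⟩

/-! ## §2  ★ The instance at the record's background field `U_{k+1}(W_B)` -/

open scoped Classical in
/-- ★ **(M8b) AT THE RECORD**: box-local gauges for `U_{k+1}(W_B)` (`recordBgUnits F θ k K B`, `θ = thetaFill F a₀ ε₂₉`, `K = K₀ + n`) on every `s`-box ⟹ the (1.12) conjunct of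
✓`RegThm1RowsAtRecord` at `B`, verbatim (§1 at `U := recordBgUnits … B`, `Rz := RzOfRecord F 2 K`).  The supplier's target for (M8b) is therefore the X-free, frame-free box statement
`hbox` — [15] Thm 1 (9) for `U_{k+1}(W_B)` on cubes of ONE size `s = side L Mc (k+2)`. [cite: Balaban1987RG1, (1.12) p.262; Balaban1985Variational, Thm 1 (9) p.279] -/
theorem regThm1GaugeRow_of_boxGauges (a₀ ε₂₉ : ℝ) (Mc k n : ℕ) (B : recordW F a₀ ε₂₉ k (recordK₀ F Mc k + n)) {α₀ : ℝ}
    (hbox : letI θ := thetaFill F a₀ ε₂₉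
      ∀ a ∈ cubeIndices (F.P (recordK₀ F Mc k + n)) (B14.Eq213MaximalDomains.side (F.P (recordK₀ F Mc k + n)).L Mc (k + 2)),
      ∃ u : Site (F.P (recordK₀ F Mc k + n)) 0 → (MatA 2)ˣ, (∀ x, u x ∈ (B12RegularSpaces111SpecialUnitary.suModel 2).G) ∧ ∃ A : PBond (F.P (recordK₀ F Mc k + n)) 0 → MatA 2,
        (∀ b ∈ (Sect2.regionOfSet (F.P (recordK₀ F Mc k + n)) (cubeEnl (F.P (recordK₀ F Mc k + n)) (B14.Eq213MaximalDomains.side (F.P (recordK₀ F Mc k + n)).L Mc (k + 2)) a 0)).bonds,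
          B12RegularSpaces111.gaugeU u (recordBgUnits F θ k (recordK₀ F Mc k + n) B) b =
            B12RegularSpaces111.expI (B12RegularSpaces111.StepConsts.ofParams (F.P (recordK₀ F Mc k + n)) (recordCB F) (k + 1)).ξ (A b)) ∧
        (∀ b ∈ (Sect2.regionOfSet (F.P (recordK₀ F Mc k + n)) (cubeEnl (F.P (recordK₀ F Mc k + n)) (B14.Eq213MaximalDomains.side (F.P (recordK₀ F Mc k + n)).L Mc (k + 2)) a 0)).bonds,
          ‖A b‖ < (B12RegularSpaces111.StepConsts.ofParams (F.P (recordK₀ F Mc k + n)) (recordCB F) (k + 1)).cB * α₀) ∧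
        ∀ q ∈ (Sect2.regionOfSet (F.P (recordK₀ F Mc k + n)) (cubeEnl (F.P (recordK₀ F Mc k + n)) (B14.Eq213MaximalDomains.side (F.P (recordK₀ F Mc k + n)).L Mc (k + 2)) a 0)).dpairs,
          ‖B12RegularSpaces111.grad (B12RegularSpaces111.StepConsts.ofParams (F.P (recordK₀ F Mc k + n)) (recordCB F) (k + 1)).ξ q.2.1 (fun y => A ⟨y, q.2.2⟩) q.1‖ <
            (B12RegularSpaces111.StepConsts.ofParams (F.P (recordK₀ F Mc k + n)) (recordCB F) (k + 1)).cB * α₀) :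
    letI θ := thetaFill F a₀ ε₂₉
    ∀ (X : (recordDomSys F Mc k (recordK₀ F Mc k + n)).Dom),
      ∀ C ∈ (Sect2.frameI (RzOfRecord F 2 (recordK₀ F Mc k + n)) Mc (k + 1) (Sect2.domSites (F.P (recordK₀ F Mc k + n)) Mc (k + 1) X)).cubes,
        ∃ u : Site (F.P (recordK₀ F Mc k + n)) 0 → (MatA 2)ˣ, (∀ x, u x ∈ (B12RegularSpaces111SpecialUnitary.suModel 2).G) ∧ ∃ A : PBond (F.P (recordK₀ F Mc k + n)) 0 → MatA 2,
          (∀ b ∈ C.bonds, B12RegularSpaces111.gaugeU u (recordBgUnits F θ k (recordK₀ F Mc k + n) B) b =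
            B12RegularSpaces111.expI (B12RegularSpaces111.StepConsts.ofParams (F.P (recordK₀ F Mc k + n)) (recordCB F) (k + 1)).ξ (A b)) ∧
          (∀ b ∈ C.bonds, ‖A b‖ < (B12RegularSpaces111.StepConsts.ofParams (F.P (recordK₀ F Mc k + n)) (recordCB F) (k + 1)).cB * α₀) ∧
          ∀ q ∈ C.dpairs, ‖B12RegularSpaces111.grad (B12RegularSpaces111.StepConsts.ofParams (F.P (recordK₀ F Mc k + n)) (recordCB F) (k + 1)).ξ q.2.1 (fun y => A ⟨y, q.2.2⟩) q.1‖ <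
            (B12RegularSpaces111.StepConsts.ofParams (F.P (recordK₀ F Mc k + n)) (recordCB F) (k + 1)).cB * α₀ :=
  fun X => localGaugeRow_of_boxGauges F Mc k (recordK₀ F Mc k + n) (RzOfRecord F 2 (recordK₀ F Mc k + n))
    (recordBgUnits F (thetaFill F a₀ ε₂₉) k (recordK₀ F Mc k + n) B) hbox X

end Summit.QuantumFields.YangMills.Theorems.BalabanUVNodesPortS1

end
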